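import Summits.CriticalPhenomena.PercolationContinuityZ3.Theorems.PercNearOneGluingNoHeavyLowerTailKnQuestion8CoefficientwiseAttachmentFlipWeak
import Summits.CriticalPhenomena.PercolationContinuityZ3.Theorems.PercNearOneGluingNoHeavyLowerTailKnQuestion8CoefficientwiseGluing
import HarnessLib

/-!
# The residue identity of the POINT ROW for an arbitrary flip-invariant selector of attached sets

Support file (`--supports stmt-CriticalPhenomena-4575`, closed), prover `prim-lf-2` (gen 35).  No definitions, no named facts, no sorries; standard axioms.
Memo `prim-lf-2/CW-INVOLUTION-gen35.md` §2.

Setting as in …CoefficientwiseAttachmentOrbit: root `x`, wall vertex `z`, points `u, w`, `σ_v(s) = 1[v ∈ C_x(s)] − 1[v ∈ C_x(E \ s)]`, wall colourings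
`s ⊆ E` with `z ∉ C_x(s) ∪ C_x(E \ s)`; `W` ATTACHED for `s`: every zone vertex `v' ∉ W ∪ {x}` joined to `W` by an edge lies in
`C_x(s \ I(W)) ∩ C_x((E \ s) \ I(W))`, `I(W)` = the edges of `E` meeting `W`.
A SELECTOR is any map `𝓦 : Finset ι → Set V` (think: `𝓦 s = A*(s)`, the smallest attached set containing the lobe of `w`; memo §2.1).  Call `s` GOOD if
`𝓦 s` is attached for `s`, `w ∈ 𝓦 s`, `u, x ∉ 𝓦 s`, and the selector is invariant under its own flip: `𝓦 (s ∆ I(𝓦 s)) = 𝓦 s`.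
* `Coefficientwise.pointRow_sum_selector_good_eq_zero` — `Σ_{s : wall, GOOD} σ_u(s) σ_w(s) = 0`: on the good colourings `s ↦ s ∆ I(𝓦 s)` is an involution
  (invariance of `𝓦`, the flip formulas of …AttachmentFlipWeak, `(s ∆ I) \ I = s \ I`) fixing `σ_u` and negating `σ_w`;
* `Coefficientwise.pointRow_sum_eq_sum_not_good` — hence the point-row sum equals its restriction to the colourings that are NOT good (the 'entangled'
  residue of the selector).  With `𝓦 = A*` (canonical: …AttachmentStable `attached_inter`; invariant: `attached_flip_iff` + invariance of zone and core),
  this is the residue identity `P(G;x,z;u,w) = 2(#conc_R^{NW} − #cross₁^{NW})` of the memo, up to the identification of `A*` with an explicit selector.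
[cite: KozmaNitzan2024, Questions 8–9 (§5.5 p. 36) (context: the Question-8 pocket covariance programme)]
-/

namespace Summit.CriticalPhenomena.PercolationContinuityZ3.Theorems

open Finset Literature.Probability.Percolation
open scoped symmDiff

namespace Coefficientwise

variable {ι V : Type*}

open Classical in
/-- **Residue identity, selector form (vanishing part).**  For any selector `𝓦`, the sum of `σ_u σ_w` over the GOOD wall colourings (selected set attached,
contains `w`, avoids `u, x`, selector invariant under its flip) is zero. [cite: KozmaNitzan2024, §5.5 (context only)] -/
theorem pointRow_sum_selector_good_eq_zero (ends : ι → Sym2 V) (E : Finset ι) (x z u w : V) (𝓦 : Finset ι → Set V) :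
    ∑ s ∈ E.powerset.filter (fun s : Finset ι =>
        (z ∉ openCluster (ends '' (↑s : Set ι)) x ∧ z ∉ openCluster (ends '' (↑(E \ s) : Set ι)) x) ∧
        ((x ∉ 𝓦 s ∧ u ∉ 𝓦 s ∧ w ∈ 𝓦 s) ∧
         𝓦 (s ∆ E.filter (fun i => ∃ v, v ∈ 𝓦 s ∧ v ∈ ends i)) = 𝓦 s ∧
         (∀ v ∈ 𝓦 s, ∀ i ∈ E, ∀ v', ends i = s(v, v') →
          (v' ∈ openCluster (ends '' (↑s : Set ι)) x ∨ v' ∈ openCluster (ends '' (↑(E \ s) : Set ι)) x) → v' ≠ x → v' ∉ 𝓦 s →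
            v' ∈ openCluster (ends '' (↑(s \ E.filter (fun i => ∃ v, v ∈ 𝓦 s ∧ v ∈ ends i)) : Set ι)) x ∧
            v' ∈ openCluster (ends '' (↑((E \ s) \ E.filter (fun i => ∃ v, v ∈ 𝓦 s ∧ v ∈ ends i)) : Set ι)) x))),
      ((if u ∈ openCluster (ends '' (↑s : Set ι)) x then (1 : ℝ) else 0) - (if u ∈ openCluster (ends '' (↑(E \ s) : Set ι)) x then (1 : ℝ) else 0)) *
        ((if w ∈ openCluster (ends '' (↑s : Set ι)) x then (1 : ℝ) else 0) - (if w ∈ openCluster (ends '' (↑(E \ s) : Set ι)) x then (1 : ℝ) else 0))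
      = 0 := by
  -- edges meeting a vertex set
  set I : Set V → Finset ι := fun W => E.filter (fun i => ∃ v, v ∈ W ∧ v ∈ ends i) with hI
  have hIE : ∀ W, I W ⊆ E := fun W => Finset.filter_subset _ _
  have memI : ∀ {W : Set V} {i : ι}, i ∈ I W ↔ i ∈ E ∧ ∃ v, v ∈ W ∧ v ∈ ends i := fun {W} {i} => by
    rw [hI]; exact Finset.mem_filter
  have sdI : ∀ (s : Finset ι) (W : Set V), (s ∆ I W) \ I W = s \ I W := by
    intro s W; ext i
    simp only [Finset.mem_sdiff, Finset.mem_symmDiff]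
    constructor
    · rintro ⟨h | h, hi⟩
      · exact ⟨h.1, hi⟩
      · exact absurd h.1 hi
    · rintro ⟨h, hi⟩
      exact ⟨Or.inl ⟨h, hi⟩, hi⟩
  have csdI : ∀ (s : Finset ι) (W : Set V), (E \ (s ∆ I W)) \ I W = (E \ s) \ I W := by
    intro s W; ext i
    simp only [Finset.mem_sdiff, Finset.mem_symmDiff, not_or, not_and, not_not]
    constructor
    · rintro ⟨⟨hE, h1, -⟩, hi⟩
      exact ⟨⟨hE, fun hs => hi (h1 hs)⟩, hi⟩
    · rintro ⟨⟨hE, hs⟩, hi⟩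
      exact ⟨⟨hE, fun h => absurd h hs, fun h => absurd h hi⟩, hi⟩
  refine Finset.sum_involution (fun s _ => s ∆ I (𝓦 s)) ?_ ?_ ?_ ?_
  · intro s hs
    rw [Finset.mem_filter, Finset.mem_powerset] at hs
    obtain ⟨hsE, hwall, ⟨hxW, huW, hwW⟩, hinv, hWa⟩ := hs
    have hwx : w ≠ x := fun h => hxW (h ▸ hwW)
    have red := mem_openCluster_flip_iff_attachment ends (E₀ := E) (s := s) (z := x) hsE (𝓦 s) hxW hWa
    have blue := mem_openCluster_sdiff_flip_iff_attachment ends (E₀ := E) (s := s) (z := x) hsE (𝓦 s) hxW hWa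
    have hu1 : (if u ∈ openCluster (ends '' (↑(s ∆ I (𝓦 s)) : Set ι)) x then (1 : ℝ) else 0) =
        (if u ∈ openCluster (ends '' (↑s : Set ι)) x then (1 : ℝ) else 0) := by
      by_cases h : u ∈ openCluster (ends '' (↑s : Set ι)) x
      · rw [if_pos h, if_pos ((red u).mpr (Or.inr (Or.inl ⟨h, huW⟩)))]
      · have h' : u ∉ openCluster (ends '' (↑(s ∆ I (𝓦 s)) : Set ι)) x := by
          intro hh
          rcases (red u).mp hh with rfl | ⟨hA, -⟩ | ⟨hW, -⟩
          · exact h (mem_openCluster_self _ _)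
          · exact h hA
          · exact huW hW
        rw [if_neg h, if_neg h']
    have hu2 : (if u ∈ openCluster (ends '' (↑(E \ (s ∆ I (𝓦 s))) : Set ι)) x then (1 : ℝ) else 0) =
        (if u ∈ openCluster (ends '' (↑(E \ s) : Set ι)) x then (1 : ℝ) else 0) := by
      by_cases h : u ∈ openCluster (ends '' (↑(E \ s) : Set ι)) x
      · rw [if_pos h, if_pos ((blue u).mpr (Or.inr (Or.inl ⟨h, huW⟩)))]
      · have h' : u ∉ openCluster (ends '' (↑(E \ (s ∆ I (𝓦 s))) : Set ι)) x := by
          intro hh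
          rcases (blue u).mp hh with rfl | ⟨hB, -⟩ | ⟨hW, -⟩
          · exact h (mem_openCluster_self _ _)
          · exact h hB
          · exact huW hW
        rw [if_neg h, if_neg h']
    have hw1 : (if w ∈ openCluster (ends '' (↑(s ∆ I (𝓦 s)) : Set ι)) x then (1 : ℝ) else 0) =
        (if w ∈ openCluster (ends '' (↑(E \ s) : Set ι)) x then (1 : ℝ) else 0) := by
      by_cases h : w ∈ openCluster (ends '' (↑(E \ s) : Set ι)) x
      · rw [if_pos h, if_pos ((red w).mpr (Or.inr (Or.inr ⟨hwW, h⟩)))]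
      · have h' : w ∉ openCluster (ends '' (↑(s ∆ I (𝓦 s)) : Set ι)) x := by
          intro hh
          rcases (red w).mp hh with hwx' | ⟨-, hW⟩ | ⟨-, hB⟩
          · exact hwx hwx'
          · exact hW hwW
          · exact h hB
        rw [if_neg h, if_neg h']
    have hw2 : (if w ∈ openCluster (ends '' (↑(E \ (s ∆ I (𝓦 s))) : Set ι)) x then (1 : ℝ) else 0) =
        (if w ∈ openCluster (ends '' (↑s : Set ι)) x then (1 : ℝ) else 0) := by
      by_cases h : w ∈ openCluster (ends '' (↑s : Set ι)) x
      · rw [if_pos h, if_pos ((blue w).mpr (Or.inr (Or.inr ⟨hwW, h⟩)))]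
      · have h' : w ∉ openCluster (ends '' (↑(E \ (s ∆ I (𝓦 s))) : Set ι)) x := by
          intro hh
          rcases (blue w).mp hh with hwx' | ⟨-, hW⟩ | ⟨-, hA⟩
          · exact hwx hwx'
          · exact hW hwW
          · exact h hA
        rw [if_neg h, if_neg h']
    rw [hu1, hu2, hw1, hw2]
    ring
  · intro s hs hf heq
    rw [Finset.mem_filter, Finset.mem_powerset] at hs
    obtain ⟨hsE, -, ⟨hxW, -, hwW⟩, -, -⟩ := hs
    have hwx : w ≠ x := fun h => hxW (h ▸ hwW)
    have hI0 : I (𝓦 s) = ∅ := by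
      have h := symmDiff_eq_left.mp heq
      simpa using h
    have noI : ∀ i ∈ E, w ∉ ends i := by
      intro i hi hwi
      have : i ∈ I (𝓦 s) := memI.mpr ⟨hi, w, hwW, hwi⟩
      rw [hI0] at this
      exact absurd this (Finset.notMem_empty i)
    have hw1 : w ∉ openCluster (ends '' (↑s : Set ι)) x := by
      intro hw
      obtain ⟨e, he, hwe⟩ := exists_edge_of_mem_openCluster ends hw hwx
      exact noI e (hsE he) hwe
    have hw2 : w ∉ openCluster (ends '' (↑(E \ s) : Set ι)) x := by
      intro hw
      obtain ⟨e, he, hwe⟩ := exists_edge_of_mem_openCluster ends hw hwx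
      exact noI e (Finset.sdiff_subset he) hwe
    apply hf
    rw [if_neg hw1, if_neg hw2, sub_zero, mul_zero]
  · intro s hs
    rw [Finset.mem_filter, Finset.mem_powerset] at hs
    obtain ⟨hsE, hwall, ⟨hxW, huW, hwW⟩, hinv, hWa⟩ := hs
    have red := mem_openCluster_flip_iff_attachment ends (E₀ := E) (s := s) (z := x) hsE (𝓦 s) hxW hWa
    have blue := mem_openCluster_sdiff_flip_iff_attachment ends (E₀ := E) (s := s) (z := x) hsE (𝓦 s) hxW hWa
    rw [Finset.mem_filter, Finset.mem_powerset]
    -- after the flip the selected set is the same set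
    have hinv' : 𝓦 (s ∆ I (𝓦 s)) = 𝓦 s := hinv
    refine ⟨?_, ⟨?_, ?_⟩, ?_, ?_, ?_⟩
    · intro i hi
      rcases Finset.mem_symmDiff.mp hi with ⟨h, -⟩ | ⟨h, -⟩
      · exact hsE h
      · exact hIE _ h
    · intro hz
      rcases (red z).mp hz with rfl | ⟨hA, -⟩ | ⟨-, hB⟩
      · exact hwall.1 (mem_openCluster_self _ _)
      · exact hwall.1 hA
      · exact hwall.2 hB
    · intro hz
      rcases (blue z).mp hz with rfl | ⟨hB, -⟩ | ⟨-, hA⟩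
      · exact hwall.1 (mem_openCluster_self _ _)
      · exact hwall.2 hB
      · exact hwall.1 hA
    · rw [hinv']
      exact ⟨hxW, huW, hwW⟩
    · rw [hinv', symmDiff_symmDiff_cancel_right]
    · rw [hinv']
      intro v hv i hi v' he hU hne hnW
      have hU' : v' ∈ openCluster (ends '' (↑s : Set ι)) x ∨ v' ∈ openCluster (ends '' (↑(E \ s) : Set ι)) x := by
        rcases hU with h | h
        · rcases (red v').mp h with h' | ⟨hA, -⟩ | ⟨hW, -⟩
          · exact absurd h' hne
          · exact Or.inl hA
          · exact absurd hW hnW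
        · rcases (blue v').mp h with h' | ⟨hB, -⟩ | ⟨hW, -⟩
          · exact absurd h' hne
          · exact Or.inr hB
          · exact absurd hW hnW
      have h := hWa v hv i hi v' he hU' hne hnW
      rw [sdI s, csdI s]
      exact h
  · intro s hs
    rw [Finset.mem_filter, Finset.mem_powerset] at hs
    obtain ⟨-, -, -, hinv, -⟩ := hs
    show (s ∆ I (𝓦 s)) ∆ I (𝓦 (s ∆ I (𝓦 s))) = s
    have hinv' : 𝓦 (s ∆ I (𝓦 s)) = 𝓦 s := hinv
    rw [hinv']
    exact symmDiff_symmDiff_cancel_right (I (𝓦 s)) s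

open Classical in
/-- **Residue identity, selector form.**  For any selector `𝓦` the point-row sum over all wall colourings equals the sum over the wall colourings that are
NOT good for `𝓦` (the residue). [cite: KozmaNitzan2024, §5.5 (context only)] -/
theorem pointRow_sum_eq_sum_not_good (ends : ι → Sym2 V) (E : Finset ι) (x z u w : V) (𝓦 : Finset ι → Set V) :
    ∑ s ∈ E.powerset.filter (fun s : Finset ι =>
        z ∉ openCluster (ends '' (↑s : Set ι)) x ∧ z ∉ openCluster (ends '' (↑(E \ s) : Set ι)) x),
      ((if u ∈ openCluster (ends '' (↑s : Set ι)) x then (1 : ℝ) else 0) - (if u ∈ openCluster (ends '' (↑(E \ s) : Set ι)) x then (1 : ℝ) else 0)) *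
        ((if w ∈ openCluster (ends '' (↑s : Set ι)) x then (1 : ℝ) else 0) - (if w ∈ openCluster (ends '' (↑(E \ s) : Set ι)) x then (1 : ℝ) else 0))
    = ∑ s ∈ E.powerset.filter (fun s : Finset ι =>
        (z ∉ openCluster (ends '' (↑s : Set ι)) x ∧ z ∉ openCluster (ends '' (↑(E \ s) : Set ι)) x) ∧
        ¬ ((x ∉ 𝓦 s ∧ u ∉ 𝓦 s ∧ w ∈ 𝓦 s) ∧
           𝓦 (s ∆ E.filter (fun i => ∃ v, v ∈ 𝓦 s ∧ v ∈ ends i)) = 𝓦 s ∧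
           (∀ v ∈ 𝓦 s, ∀ i ∈ E, ∀ v', ends i = s(v, v') →
            (v' ∈ openCluster (ends '' (↑s : Set ι)) x ∨ v' ∈ openCluster (ends '' (↑(E \ s) : Set ι)) x) → v' ≠ x → v' ∉ 𝓦 s →
              v' ∈ openCluster (ends '' (↑(s \ E.filter (fun i => ∃ v, v ∈ 𝓦 s ∧ v ∈ ends i)) : Set ι)) x ∧
              v' ∈ openCluster (ends '' (↑((E \ s) \ E.filter (fun i => ∃ v, v ∈ 𝓦 s ∧ v ∈ ends i)) : Set ι)) x))),
      ((if u ∈ openCluster (ends '' (↑s : Set ι)) x then (1 : ℝ) else 0) - (if u ∈ openCluster (ends '' (↑(E \ s) : Set ι)) x then (1 : ℝ) else 0)) *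
        ((if w ∈ openCluster (ends '' (↑s : Set ι)) x then (1 : ℝ) else 0) - (if w ∈ openCluster (ends '' (↑(E \ s) : Set ι)) x then (1 : ℝ) else 0)) := by
  have h0 := pointRow_sum_selector_good_eq_zero ends E x z u w 𝓦
  set S₀ : Finset (Finset ι) := E.powerset.filter (fun s : Finset ι =>
      z ∉ openCluster (ends '' (↑s : Set ι)) x ∧ z ∉ openCluster (ends '' (↑(E \ s) : Set ι)) x) with hS₀
  set P : Finset ι → Prop := fun s : Finset ι =>
      (x ∉ 𝓦 s ∧ u ∉ 𝓦 s ∧ w ∈ 𝓦 s) ∧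
      𝓦 (s ∆ E.filter (fun i => ∃ v, v ∈ 𝓦 s ∧ v ∈ ends i)) = 𝓦 s ∧
      (∀ v ∈ 𝓦 s, ∀ i ∈ E, ∀ v', ends i = s(v, v') →
        (v' ∈ openCluster (ends '' (↑s : Set ι)) x ∨ v' ∈ openCluster (ends '' (↑(E \ s) : Set ι)) x) → v' ≠ x → v' ∉ 𝓦 s →
          v' ∈ openCluster (ends '' (↑(s \ E.filter (fun i => ∃ v, v ∈ 𝓦 s ∧ v ∈ ends i)) : Set ι)) x ∧
          v' ∈ openCluster (ends '' (↑((E \ s) \ E.filter (fun i => ∃ v, v ∈ 𝓦 s ∧ v ∈ ends i)) : Set ι)) x) with hP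
  set f : Finset ι → ℝ := fun s : Finset ι =>
      ((if u ∈ openCluster (ends '' (↑s : Set ι)) x then (1 : ℝ) else 0) - (if u ∈ openCluster (ends '' (↑(E \ s) : Set ι)) x then (1 : ℝ) else 0)) *
        ((if w ∈ openCluster (ends '' (↑s : Set ι)) x then (1 : ℝ) else 0) - (if w ∈ openCluster (ends '' (↑(E \ s) : Set ι)) x then (1 : ℝ) else 0))
    with hf
  have h1 : ∑ s ∈ S₀, f s = ∑ s ∈ S₀.filter P, f s + ∑ s ∈ S₀.filter (fun s => ¬ P s), f s :=
    (Finset.sum_filter_add_sum_filter_not S₀ P f).symm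
  have h2 : S₀.filter P = E.powerset.filter (fun s : Finset ι =>
      (z ∉ openCluster (ends '' (↑s : Set ι)) x ∧ z ∉ openCluster (ends '' (↑(E \ s) : Set ι)) x) ∧ P s) := by
    rw [hS₀, Finset.filter_filter]
  have h3 : S₀.filter (fun s => ¬ P s) = E.powerset.filter (fun s : Finset ι =>
      (z ∉ openCluster (ends '' (↑s : Set ι)) x ∧ z ∉ openCluster (ends '' (↑(E \ s) : Set ι)) x) ∧ ¬ P s) := by
    rw [hS₀, Finset.filter_filter]
  have h0' : ∑ s ∈ S₀.filter P, f s = 0 := by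
    rw [h2]
    exact h0
  rw [h1, h0', zero_add, h3]

end Coefficientwise

end Summit.CriticalPhenomena.PercolationContinuityZ3.Theorems
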